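import Literature.AlgebraicGeometry.Modules.PullbackContract
import Literature.AlgebraicGeometry.Modules.PullbackDualNaturality
import Literature.AlgebraicGeometry.HodgeTheory.HodgeSheafPullbackForms
import Literature.AlgebraicGeometry.HodgeTheory.AtiyahClassTraceNaturality
import Literature.AlgebraicGeometry.HodgeTheory.HigherSigmaOfIso
import HarnessLib

/-!
# The twisted Homs `E ⊗ Ωʲ` along the pull-back by a morphism of `S`-schemes

Layer `Literature/AlgebraicGeometry/HodgeTheory`; the PULL-BACK companion of `TwistJetPushforwardIso.lean` §1 (which compares
`e_*(E ⊗ Ωʲ)` with `e_*E ⊗ Ωʲ` along an ISOMORPHISM `e` of `S`-schemes) and the sequel of `Modules/PullbackDual.lean`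
(`pullbackTwistComparison f hE G : f^*𝓗om(E^∨, G) ⟶ 𝓗om((f^*E)^∨, f^*G)`), `Modules/PullbackContract.lean` (`pullback_map_contract`:
the contraction commutes with `f^*`) and `HodgeSheafPullbackForms.lean` (`pullbackForms g j : g^*Ωʲ_{X₁} ⟶ Ωʲ_{X₀}`, i.e. `dg` on
`j`-forms). For ANY morphism `g : X₀ ⟶ X₁` of `S`-schemes (`g.left` the morphism of schemes, `g^* = Scheme.Modules.pullback g.left`)
and a finite locally free `𝒪_{X₁}`-module `E` (`E ⊗ Ωʲ` in the tree's model `twistHodge E j = 𝓗om(E^∨, Ωʲ)`):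

* **`twistHodgePullbackHom g hE j : g^*(E ⊗ Ωʲ_{X₁}) ⟶ g^*E ⊗ Ωʲ_{X₀}`** — the twist comparison followed by `𝓗om((g^*E)^∨, dg)`
  (`α_j`; for an isomorphism it is the `twistHodgePushforwardIso` of `TwistJetPushforwardIso.lean` read backwards);
* `twistHodgePullbackHom_naturality` — `α_j` is natural in `E` (`g^*(φ ⊗ 1) ≫ α_j = α_j ≫ (g^*φ ⊗ 1)`);
* **`pullback_map_contract_comp_pullbackForms`** — the module-level core of the compatibility of the Buchweitz–Flenner trace
  with pull-back: `g^*(c^E_{Ω^q}) ≫ dg = (g^*𝓗om(E, E ⊗ Ω^q) ⟶ 𝓗om(g^*E, g^*(E ⊗ Ω^q))) ≫ 𝓗om(g^*E, α_q) ≫ c^{g^*E}_{Ω^q}`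
  (`pullback_map_contract` and the naturality of the contraction in the coefficients, `sheafHomMap_sheafHomMap_comp_contract`).

Everything is a construction or a proved lemma; no named facts, no new notion. What is NOT here: the jet modules `Pʲ(E)` along `g^*`
(«jets commute with flat base change»), i.e. the comparison `g^* Pʲ(E) ⟶ Pʲ(g^*E)` and the Atiyah steps along `g^*`; the statement that
`α_j` is an isomorphism for `g` étale (it is the composite of an isomorphism with `𝓗om((g^*E)^∨, dg)`). Motivation: steps (Q4)∕(Q5) of the
typing plan of the library item (L2) `SigmaPullbackCompat` (crux stmt-HodgeConjecture-26512, support line «sigma-descent-along-q»);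
nothing of that crux is asserted here.

## References

* R.-O. Buchweitz, H. Flenner, *A semiregularity map for modules and applications to deformations*, Compositio Math. 137 (2003), §3
  (functoriality of the Atiyah class and of the trace maps under base change) and §4. [BuchweitzFlenner2003]
* R. Hartshorne, *Algebraic Geometry*, GTM 52 (1977), II Ex. 5.1 (b), (d) (`𝓗om(E^∨, G) ≅ E ⊗ G`), II Prop. 8.11 (`dg` on forms),
  II §5 p. 110 (`f^* ⊣ f_*`). [Hartshorne1977]
* U. Görtz, T. Wedhorn, *Algebraic Geometry I*, 2nd ed. (2020), (7.8.3) and Exercise 7.20 (a). [GortzWedhorn2020]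
-/

noncomputable section

-- `TopCat.Presheaf`/`Scheme.Modules` are not reducible (as in Mathlib's `AlgebraicGeometry/Modules/Sheaf.lean`).
set_option backward.isDefEq.respectTransparency false

open CategoryTheory CategoryTheory.Limits AlgebraicGeometry Opposite
open AlgebraicGeometry.Scheme.Modules

universe u

namespace Literature.AlgebraicGeometry.HodgeTheory

open Literature.AlgebraicGeometry.Modules Literature.AlgebraicGeometry.Motives

variable {S : Type u} [CommRing S] {X₀ X₁ : Over (Spec (CommRingCat.of S))} (g : X₀ ⟶ X₁)

/-! ## §1 The comparison `α_j : g^*(E ⊗ Ωʲ) ⟶ g^*E ⊗ Ωʲ` and its naturality in `E` -/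

section Twist

variable {E : X₁.left.Modules} (hE : IsFiniteLocallyFree E) (j : ℕ)

/-- **`α_j : g^*(E ⊗ Ωʲ_{X₁/S}) ⟶ g^*E ⊗ Ωʲ_{X₀/S}`** for a morphism `g : X₀ ⟶ X₁` of `S`-schemes and `E` finite locally free, in the
model `E ⊗ Ωʲ = 𝓗om(E^∨, Ωʲ)`: the twist comparison `g^*𝓗om(E^∨, Ωʲ_{X₁}) ⟶ 𝓗om((g^*E)^∨, g^*Ωʲ_{X₁})` (`Modules/PullbackDual`) followed by
`𝓗om((g^*E)^∨, dg)` with `dg : g^*Ωʲ_{X₁} ⟶ Ωʲ_{X₀}` the pull-back of `j`-forms (`pullbackForms`).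
[cite: Hartshorne1977, II Ex. 5.1 (b), (d) and II Prop. 8.11] [cite: BuchweitzFlenner2003, §3 (base change of E ⊗ Ω)] -/
def twistHodgePullbackHom :
    (Scheme.Modules.pullback g.left).obj (twistHodge E j) ⟶ twistHodge ((Scheme.Modules.pullback g.left).obj E) j :=
  pullbackTwistComparison g.left hE (hodgeSheaf X₁ j) ≫
    sheafHomMap (dual ((Scheme.Modules.pullback g.left).obj E)) (pullbackForms g j)

/-- Unfolding `α_j` (definitional). [cite: Hartshorne1977, II Ex. 5.1 (b), (d) and II Prop. 8.11] -/
theorem twistHodgePullbackHom_eq :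
    twistHodgePullbackHom g hE j =
      pullbackTwistComparison g.left hE (hodgeSheaf X₁ j) ≫
        sheafHomMap (dual ((Scheme.Modules.pullback g.left).obj E)) (pullbackForms g j) :=
  rfl

/-- **Naturality of `α_j` in `E`**: for `φ : E₁ ⟶ E₂` between finite locally free modules,
`g^*(φ ⊗ 1) ≫ α_j(E₂) = α_j(E₁) ≫ (g^*φ ⊗ 1)` (`φ ⊗ 1 = twistMap φ Ωʲ = 𝓗om(φ^∨, Ωʲ)`; the twist comparison is natural in the first
variable, `pullbackTwistComparison_naturality_left`, and pre- and post-composition on `𝓗om` commute).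
[cite: Hartshorne1977, II Ex. 5.1 (b), (d)] [cite: BuchweitzFlenner2003, §3 (base change of E ⊗ Ω)] -/
theorem twistHodgePullbackHom_naturality {E₁ E₂ : X₁.left.Modules} (φ : E₁ ⟶ E₂) (hE₁ : IsFiniteLocallyFree E₁)
    (hE₂ : IsFiniteLocallyFree E₂) :
    (Scheme.Modules.pullback g.left).map (twistMap φ (hodgeSheaf X₁ j)) ≫ twistHodgePullbackHom g hE₂ j =
      twistHodgePullbackHom g hE₁ j ≫ twistMap ((Scheme.Modules.pullback g.left).map φ) (hodgeSheaf X₀ j) := by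
  simp only [twistHodgePullbackHom, twistMap, sheafHomPrecomp_eq_sheafHomMapLeft]
  rw [← Category.assoc, pullbackTwistComparison_naturality_left g.left φ hE₁ hE₂ (hodgeSheaf X₁ j), Category.assoc,
    Category.assoc, sheafHomMapLeft_sheafHomMap]

end Twist

/-! ## §2 The contraction with coefficients `Ω^q` along `g^*`, landing in `Ω^q_{X₀}` -/

section Contract

variable {E : X₁.left.Modules} (hE : IsFiniteLocallyFree E) (q : ℕ)

/-- **The contraction with coefficients `Ω^q` along `g^*`, landing in `Ω^q_{X₀}`** — the module-level core of the compatibility of the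
Buchweitz–Flenner trace maps with pull-back: for `E` finite locally free on `X₁`,
`g^*(c^E_{Ω^q_{X₁}}) ≫ dg = (g^*𝓗om(E, E ⊗ Ω^q) ⟶ 𝓗om(g^*E, g^*(E ⊗ Ω^q))) ≫ 𝓗om(g^*E, α_q) ≫ c^{g^*E}_{Ω^q_{X₀}}`
(`pullback_map_contract`: the contraction commutes with `g^*`; then the contraction is natural in the coefficient module,
`sheafHomMap_sheafHomMap_comp_contract`, applied to `dg`).
[cite: BuchweitzFlenner2003, §3 (functoriality of the trace under base change) and §4]
[cite: Hartshorne1977, II Ex. 5.1 (b) and II Prop. 8.11] -/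
theorem pullback_map_contract_comp_pullbackForms :
    (Scheme.Modules.pullback g.left).map (contract hE (hodgeSheaf X₁ q)) ≫ pullbackForms g q =
      sheafHomPullbackComparison g.left E (twistHodge E q) ≫
        sheafHomMap ((Scheme.Modules.pullback g.left).obj E) (twistHodgePullbackHom g hE q) ≫
          contract (hE.pullback g.left) (hodgeSheaf X₀ q) := by
  rw [pullback_map_contract g.left hE (hodgeSheaf X₁ q), Category.assoc, Category.assoc, twistHodgePullbackHom, sheafHomMap_comp,
    Category.assoc, sheafHomMap_sheafHomMap_comp_contract (hE.pullback g.left) (pullbackForms g q)]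

end Contract

end Literature.AlgebraicGeometry.HodgeTheory

end
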